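import Summits.CriticalPhenomena.PercolationContinuityZ3.Theorems.PercNearOneGluingNoHeavyLowerTailIncStarTwoSepCorollaries
import HarnessLib

/-!
# The increasing star on cactus environments: leaf-block elimination

Support file for the Sahi programme (`--supports stmt-CriticalPhenomena-4575`, prover prim-sahi-p2 gen 23).  No definitions, no named
facts, no sorries; standard axioms.  Memo `run/shared/lean/prim/prim-sahi/FROM-prim-sahi-p2-gen22-TWO-SEPARATION-GLUING.md` §3
(COROLLARY C), `prim-sahi-p2/PROOF-E3.md` §33.

**COROLLARY C in kernel form.**  Root `s`, weight `w` on `Fin n`.  A LEAF-BLOCK ELIMINATION of length `m` is a chain of vertex sets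
`univ = K 0 ⊇ K 1 ⊇ ⋯ ⊇ K m ∋ s` with `K (i+1) = K i ∖ L i`, attachment vertices `x i ∈ K (i+1) ∖ {s}` and `s ∉ L i`, such that
* no positive pair joins `L i` to `K (i+1) ∖ {s, x i}` (so inside `K i` the vertex `x i` separates `L i` from the rest of the
  environment — `insert (x i) (L i)` is a union of blocks of the environment `G[K i] − s` hanging at `x i`, or a bunch of components when
  no pair meets `x i` at all; the root pairs are unrestricted);
* the positive pairs inside `insert (x i) (L i)` avoiding `s` form a forest after deleting one pair `z i` (an apex-unicyclic piece);
* the positive pairs inside the final set `K m` avoiding `s` form a forest after deleting one pair `z m`.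
Then `0 ≤ E₃({s↔a},{s↔b},{s↔c})` for all targets (`incStar_nonneg_of_leafBlockElimination`).  Every weight whose environment `G − s` is a
CACTUS FOREST (each block a cycle or a bridge) admits such an elimination — peel one leaf block (or one whole component) at a time —, with
arbitrary root pairs; this is memo §3's COROLLARY C, the combinatorial existence of the elimination being the (standard, paper-level) input.
Proof: downward induction along the chain of the ROBUST relative statement "STAR inside `K i` under every re-weighting of the root pairs",
each step being the composable block property `IncStar.incStar_openConnIn_nonneg_of_envCutVertex` (THEOREM G + lobe) fed by the relative
apex-unicyclic theorem `IncStar.incStar_openConnIn_nonneg_of_apexUnicyclic` on the peeled piece.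
-/

noncomputable section

namespace Summit.CriticalPhenomena.PercolationContinuityZ3.Theorems

namespace IncStar

open MeasureTheory Set Literature.Probability.Percolation Literature.Probability.LatticeModels
open scoped Classical

variable {n : ℕ}

/-- **The increasing star along a leaf-block elimination (COROLLARY C: cactus environments).**  See the module docstring: a chain
`univ = K 0 ⊇ ⋯ ⊇ K m ∋ s`, `K (i+1) = K i ∖ L i`, attachment vertices `x i ∈ K (i+1)`, `x i ≠ s`, `s ∉ L i`, no positive pair from `L i`
to `K (i+1) ∖ {s, x i}`, each peeled piece `insert (x i) (L i)` and the final `K m` apex-unicyclic (their positive pairs avoiding `s` form a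
forest after deleting one pair) ⟹ `0 ≤ E₃({s↔a},{s↔b},{s↔c})` for all targets, whatever the root pairs. [this work] -/
theorem incStar_nonneg_of_leafBlockElimination (w : Sym2 (Fin n) → unitInterval) (s : Fin n) (m : ℕ)
    (K L : ℕ → Set (Fin n)) (x : ℕ → Fin n) (z : ℕ → Sym2 (Fin n))
    (hK0 : K 0 = Set.univ) (hsK : ∀ i ≤ m, s ∈ K i) (hKsucc : ∀ i < m, K (i + 1) = K i \ L i)
    (hx : ∀ i < m, x i ∈ K (i + 1) ∧ x i ≠ s) (hL : ∀ i < m, L i ⊆ K i ∧ s ∉ L i)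
    (hsep : ∀ i < m, ∀ y t : Fin n, y ∈ L i → t ∈ K (i + 1) → t ≠ s → t ≠ x i → w s(y, t) = 0)
    (hblock : ∀ i < m, ((SimpleGraph.fromEdgeSet
      {e : Sym2 (Fin n) | s ∉ e ∧ (∀ y ∈ e, y ∈ (insert (x i) (L i) : Set (Fin n))) ∧ w e ≠ 0}).deleteEdges {z i}).IsAcyclic)
    (hcore : ((SimpleGraph.fromEdgeSet {e : Sym2 (Fin n) | s ∉ e ∧ (∀ y ∈ e, y ∈ K m) ∧ w e ≠ 0}).deleteEdges {z m}).IsAcyclic)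
    (a b c : Fin n) :
    0 ≤ sahiE3 (prodBernoulli w) (openConn s a) (openConn s b) (openConn s c) := by
  -- environments do not see the root pairs
  have henv : ∀ (w' : Sym2 (Fin n) → unitInterval) (S : Set (Fin n)), (∀ e : Sym2 (Fin n), s ∉ e → w' e = w e) →
      {e : Sym2 (Fin n) | s ∉ e ∧ (∀ y ∈ e, y ∈ S) ∧ w' e ≠ 0} = {e : Sym2 (Fin n) | s ∉ e ∧ (∀ y ∈ e, y ∈ S) ∧ w e ≠ 0} := by
    intro w' S hw'
    ext e
    simp only [Set.mem_setOf_eq]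
    constructor
    · rintro ⟨hs, hS, hw⟩; exact ⟨hs, hS, by rwa [hw' e hs] at hw⟩
    · rintro ⟨hs, hS, hw⟩; exact ⟨hs, hS, by rwa [hw' e hs]⟩
  have hupd : ∀ (w' : Sym2 (Fin n) → unitInterval) (y : Fin n) (v : unitInterval), (∀ e : Sym2 (Fin n), s ∉ e → w' e = w e) →
      ∀ e : Sym2 (Fin n), s ∉ e → Function.update w' s(s, y) v e = w e := by
    intro w' y v hw' e hs
    rw [Function.update_of_ne (show e ≠ s(s, y) by rintro rfl; exact hs (Sym2.mem_mk_left s y))]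
    exact hw' e hs
  -- the robust relative statement along the chain, by downward induction
  have main : ∀ j ≤ m, ∀ w' : Sym2 (Fin n) → unitInterval, (∀ e : Sym2 (Fin n), s ∉ e → w' e = w e) →
      ∀ t₁ t₂ t₃ : Fin n, t₁ ∈ K (m - j) → t₂ ∈ K (m - j) → t₃ ∈ K (m - j) →
        0 ≤ sahiE3 (prodBernoulli w') (openConnIn (K (m - j)) s t₁) (openConnIn (K (m - j)) s t₂) (openConnIn (K (m - j)) s t₃) := by
    intro j
    induction j with
    | zero =>
      intro _ w' hw' t₁ t₂ t₃ h₁ h₂ h₃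
      rw [Nat.sub_zero] at h₁ h₂ h₃ ⊢
      refine incStar_openConnIn_nonneg_of_apexUnicyclic w' (hsK m le_rfl) h₁ h₂ h₃ (z m) ?_
      rw [henv w' _ hw']; exact hcore
    | succ j ih =>
      intro hj w' hw' t₁ t₂ t₃ h₁ h₂ h₃
      set i := m - (j + 1) with hi
      have him : i < m := by omega
      have hi1 : m - j = i + 1 := by omega
      have IH := ih (by omega)
      rw [hi1] at IH
      obtain ⟨hxK1, hxs⟩ := hx i him
      obtain ⟨hLK, hsL⟩ := hL i him
      have hK1 := hKsucc i him
      have hxK : x i ∈ K i := by rw [hK1] at hxK1; exact hxK1.1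
      have hxL : x i ∉ L i := by rw [hK1] at hxK1; exact hxK1.2
      have hsKi : s ∈ K i := hsK i him.le
      refine incStar_openConnIn_nonneg_of_envCutVertex w' hxs hsKi hxK hLK hsL hxL (fun y t hy ht htL hts htx => ?_)
        (fun v u₁ u₂ u₃ hu₁ hu₂ hu₃ => ?_) (fun v u₁ u₂ u₃ hu₁ hu₂ hu₃ => ?_) h₁ h₂ h₃
      · -- no positive pair from `L i` to `K (i+1) ∖ {s, x i}` (a non-root pair, so `w'` agrees with `w`)
        rw [hw' _ (fun h => ?_)]
        · exact hsep i him y t hy (by rw [hK1]; exact ⟨ht, htL⟩) hts htx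
        · rcases Sym2.mem_iff.1 h with h | h
          · exact hsL (h ▸ hy)
          · exact hts h.symm
      · -- the peeled piece is apex-unicyclic under every root re-weighting
        refine incStar_openConnIn_nonneg_of_apexUnicyclic _ (Set.mem_insert s _) hu₁ hu₂ hu₃ (z i) ?_
        have hset : {e : Sym2 (Fin n) | s ∉ e ∧ (∀ y ∈ e, y ∈ (insert s (insert (x i) (L i)) : Set (Fin n)))
              ∧ Function.update w' s(s, x i) v e ≠ 0}
            = {e : Sym2 (Fin n) | s ∉ e ∧ (∀ y ∈ e, y ∈ (insert (x i) (L i) : Set (Fin n))) ∧ w e ≠ 0} := by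
          rw [henv _ _ (hupd w' (x i) v hw')]
          ext e
          simp only [Set.mem_setOf_eq]
          constructor
          · rintro ⟨hs, hS, hw⟩
            refine ⟨hs, fun y hy => ?_, hw⟩
            rcases Set.mem_insert_iff.1 (hS y hy) with h | h
            · exact absurd hy (h ▸ hs)
            · exact h
          · rintro ⟨hs, hS, hw⟩
            exact ⟨hs, fun y hy => Set.mem_insert_of_mem s (hS y hy), hw⟩
        rw [hset]; exact hblock i him
      · -- the rest `K (i+1)` under every root re-weighting: the induction hypothesis
        rw [← hK1] at hu₁ hu₂ hu₃ ⊢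
        exact IH _ (hupd w' (x i) v hw') u₁ u₂ u₃ hu₁ hu₂ hu₃
  have key := main m le_rfl w (fun _ _ => rfl) a b c
  rw [Nat.sub_self, hK0] at key
  simpa only [IncStarIrreducible.openConn_eq_openConnIn_univ] using key (Set.mem_univ a) (Set.mem_univ b) (Set.mem_univ c)

end IncStar

end Summit.CriticalPhenomena.PercolationContinuityZ3.Theorems
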